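import Mathlib
import HarnessLib
import Summits.HubbardSuperconductivity.HubbardSuperconductivity.Theorems.WeakCouplingBCSDefsKlThirdOrderChains

/-!
# Route `WeakCouplingBCS` — channel-margin lane of `WcbcsKohnLuttingerB1g` (stmt-HubbardSuperconductivity-0158):
# JOIN bookkeeping for windows of rows (append / monotonicity of `klThirdOrderWindowJoin` and of the rows' constant check)

The explicit-`U₀` lane covers the doping window of record by SEVERAL row-record files (`klU0WindowRows` on `[-0.42749, -0.1775]`,
the `Win{Z,Y,X}` and `Win{W,V,U3,U2,U1}` extensions towards `δ = 0.35`), each with its own kernel-checked join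
`klThirdOrderWindowJoin rows recs = true` against its own second-order records.  The window theorems on the CONCATENATED row lists
(`Theorems/WeakCouplingBCSKlSelectionWindowRows.lean`) need the join of the concatenation against the union of the records; instead of one
large kernel decision this file provides the list bookkeeping:
* `klThirdOrderWindowJoin_append` (join of `r₁ ++ r₂` = both joins), `klThirdOrderWindowJoin_mono` (more records keep a join),
  `klThirdOrderWindowJoin_append_of` (the combination used by the instances);
* `klWindowRowsConsts_append` (the `C4`/`U1` side condition of `klAllOrders_selection_windowRows` on `r₁ ++ r₂`);
* `klWindowRecs_append` (the records' `checkB1gD ∧ EnclosuresB1g` hypothesis on `recs₁ ++ recs₂`), `klWindowRowsB1g_append`,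
  `klThirdOrderWindowEnclosures_append`, `klResummedWindowEnclosures_append` (the named window hypotheses of `r₁ ++ r₂` from the parts').
Pure list logic; no numbers, no definitions; nothing here asserts superconductivity.  Cell file: U0-TABLE.md v4 (gate-hubbard-kl, margin-1 g9).
-/

noncomputable section

-- the tree's namespace `Summit.<Summit>.<Problem>.Theorems` repeats the summit name by design (D-0017)
set_option linter.dupNamespace false

namespace Summit.HubbardSuperconductivity.HubbardSuperconductivity.Theorems

open CwKLChiralWindow Literature.MathematicalPhysics.QuantumLattice

/-- The join of a concatenated row list is the conjunction of the two joins. [folklore] -/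
theorem klThirdOrderWindowJoin_append (r₁ r₂ : List KLU0WinRow) (recs : List KLCert) :
    klThirdOrderWindowJoin (r₁ ++ r₂) recs = (klThirdOrderWindowJoin r₁ recs && klThirdOrderWindowJoin r₂ recs) := by
  simp [klThirdOrderWindowJoin, List.all_append]

/-- A join survives enlarging the record list. [folklore] -/
theorem klThirdOrderWindowJoin_mono {rows : List KLU0WinRow} {recs₁ recs₂ : List KLCert}
    (h : klThirdOrderWindowJoin rows recs₁ = true) (hsub : ∀ c ∈ recs₁, c ∈ recs₂) :
    klThirdOrderWindowJoin rows recs₂ = true := by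
  unfold klThirdOrderWindowJoin at h ⊢
  simp only [List.all_eq_true, List.any_eq_true] at h ⊢
  intro w hw
  obtain ⟨c, hc, bx, hbx, hh⟩ := h w hw
  exact ⟨c, hsub c hc, bx, hbx, hh⟩

/-- **Join of a concatenation against the concatenated records**: if `r₁` is joined to `recs₁` and `r₂` to `recs₂` then `r₁ ++ r₂` is
joined to `recs₁ ++ recs₂`. [folklore] -/
theorem klThirdOrderWindowJoin_append_of {r₁ r₂ : List KLU0WinRow} {recs₁ recs₂ : List KLCert}
    (h₁ : klThirdOrderWindowJoin r₁ recs₁ = true) (h₂ : klThirdOrderWindowJoin r₂ recs₂ = true) :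
    klThirdOrderWindowJoin (r₁ ++ r₂) (recs₁ ++ recs₂) = true := by
  rw [klThirdOrderWindowJoin_append, Bool.and_eq_true]
  exact ⟨klThirdOrderWindowJoin_mono h₁ fun c hc => List.mem_append_left _ hc,
    klThirdOrderWindowJoin_mono h₂ fun c hc => List.mem_append_right _ hc⟩

/-- The rows' common-constants side condition (`C4 = C4₀ ∧ U1 = U1₀` on every row) on a concatenation. [folklore] -/
theorem klWindowRowsConsts_append {r₁ r₂ : List KLU0WinRow} {C4₀ U1₀ : ℚ}
    (h₁ : (r₁.all fun w => decide (w.row.C4 = C4₀) && decide (w.row.U1 = U1₀)) = true)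
    (h₂ : (r₂.all fun w => decide (w.row.C4 = C4₀) && decide (w.row.U1 = U1₀)) = true) :
    ((r₁ ++ r₂).all fun w => decide (w.row.C4 = C4₀) && decide (w.row.U1 = U1₀)) = true := by
  rw [List.all_append, Bool.and_eq_true]
  exact ⟨h₁, h₂⟩

/-- The records' hypothesis (`checkB1gD ∧ EnclosuresB1g` for every record) on a concatenation. [folklore] -/
theorem klWindowRecs_append {recs₁ recs₂ : List KLCert}
    (h₁ : ∀ c ∈ recs₁, c.checkB1gD = true ∧ c.EnclosuresB1g) (h₂ : ∀ c ∈ recs₂, c.checkB1gD = true ∧ c.EnclosuresB1g) :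
    ∀ c ∈ recs₁ ++ recs₂, c.checkB1gD = true ∧ c.EnclosuresB1g := by
  intro c hc
  rcases List.mem_append.1 hc with h | h
  · exact h₁ c h
  · exact h₂ c h

/-- The `B1g`-side extra hypothesis of the channel-bottom theorems (each row's `A2g` datum read on the `B1g` states) on a concatenation.
[folklore] -/
theorem klWindowRowsB1g_append {r₁ r₂ : List KLU0WinRow}
    (h₁ : ∀ w ∈ r₁, ∀ μ : ℝ, ((w.mulo : ℚ) : ℝ) ≤ μ → μ ≤ ((w.muhi : ℚ) : ℝ) →
      (w.row.chanOf D4Irrep.A2g).ThirdOrderLowerBound μ D4Irrep.B1g)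
    (h₂ : ∀ w ∈ r₂, ∀ μ : ℝ, ((w.mulo : ℚ) : ℝ) ≤ μ → μ ≤ ((w.muhi : ℚ) : ℝ) →
      (w.row.chanOf D4Irrep.A2g).ThirdOrderLowerBound μ D4Irrep.B1g) :
    ∀ w ∈ r₁ ++ r₂, ∀ μ : ℝ, ((w.mulo : ℚ) : ℝ) ≤ μ → μ ≤ ((w.muhi : ℚ) : ℝ) →
      (w.row.chanOf D4Irrep.A2g).ThirdOrderLowerBound μ D4Irrep.B1g := by
  intro w hw
  rcases List.mem_append.1 hw with h | h
  · exact h₁ w h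
  · exact h₂ w h

/-- The named THIRD-ORDER window hypotheses of a concatenation follow from those of the parts (against the concatenated records: a row of
`r₁` joined to a box of `recs₂` is covered too, since the hypothesis quantifies over all records). [folklore] -/
theorem klThirdOrderWindowEnclosures_append {r₁ r₂ : List KLU0WinRow} {recs : List KLCert}
    (h₁ : KlThirdOrderWindowEnclosures r₁ recs) (h₂ : KlThirdOrderWindowEnclosures r₂ recs) :
    KlThirdOrderWindowEnclosures (r₁ ++ r₂) recs := by
  intro w hw
  rcases List.mem_append.1 hw with h | h
  · exact h₁ w h
  · exact h₂ w h

/-- The named RESUMMED window hypotheses of a concatenation follow from those of the parts. [folklore] -/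
theorem klResummedWindowEnclosures_append {r₁ r₂ : List KLU0WinRow} {recs : List KLCert}
    (h₁ : KlResummedWindowEnclosures r₁ recs) (h₂ : KlResummedWindowEnclosures r₂ recs) :
    KlResummedWindowEnclosures (r₁ ++ r₂) recs := by
  intro w hw
  rcases List.mem_append.1 hw with h | h
  · exact h₁ w h
  · exact h₂ w h

end Summit.HubbardSuperconductivity.HubbardSuperconductivity.Theorems

end
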